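import Summits.QuantumFields.YangMills.Theorems.AlphaInputsT3ACv3SymAvgSixtyNine
import Summits.QuantumFields.YangMills.Theorems.AlphaInputsT3ACv3SymAvgReg68Reading
import Summits.QuantumFields.YangMills.Theorems.AlphaInputsT3ACv3SmallFactor71SymT3
import Summits.QuantumFields.YangMills.Theorems.UnitScaleTiltMinimiserStabilityRegPrAvgActionDefect
import HarnessLib

/-!
# `AlphaInputsT3ACv3SymAvgSixtyNineT3` — R3 2′χ (O″χ) B1, the (α)-seam re-reading R-ii: **(69)_sym AT THE CLASS OF RECORD** — for `U₀ ∈ reg68LocalSet k h` on `T³` (SU(2), the run's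
# scales), every recorded coarse plaquette `p′ ∈ P_j(h)` satisfies
# `|Ū₀^{(j)}(∂p′) − 1| < blockSum (L^j) (L^j•z(p′)) μ ν (dev (lift U₀) μ ν) + b`, `0 ≤ b ≤ C₂(L)·eps1Of(j)²`, `C₂(L) = (207360000·L + 1331529∕4)·C68²`, under ONE displayed window
# `648000·L·C68·eps1Of(j) ≤ 1` and `5 ≤ L` — VERBATIM the `h69` binder of LEAD's ✓`AlphaInputsT3AC.h71_of_recLarge_of_eq69sym`; whence the v4 `h71` text for such `U₀` from
# `large67RecSet ∧ reg68LocalSet` and the record windows — lane `pub-balaban3d` ∕ cell `ym3-torus`, seat `ym-ust-19936-w2` (g4)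

WHY (★★OWNER RULING g26-№14 (c); LEAD ★w1-19936 g3 B1 PLAN v3 + 08:12:21Z «once (69)_sym lands in that `h69` shape, the v4 seam obligation for print's map is DISCHARGED from
B1's class rows»).  The four pieces are in the tree: (i) ✓`…LinAvgIterFluxRigid` (★w6 g2), (ii) ✓`…SymAvgCoverGeometry`∕✓`…SymAvgGaugeClamp` (this seat), (iii)+(iv)+knit
✓`…SymAvgPlaqAssembly`∕✓`…SymAvgBlockSum69` and the assembly ✓`SymAvgSixtyNine.dist1_plaqHol_iter_le_blockSum_of_cover` (★w7 g3), the (68) reading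
✓`SymAvgCover.norm_plaqHol_le_of_mem_reg68LocalSet` (this seat), and LEAD's currency-free (70)–(71) core ✓`…SmallFactor71Sym(T3)`.  THIS FILE is the last twenty lines of
arithmetic: at the (68) radius `a = ½C68·ε·L^{−2j}`, `ε = eps1Of(j) = g_jp(g_j)`, the assembly's `δ = (d+2)·L^j·a` gives `L^j·δ = (5∕2)·C68·ε` and `m_j = 80·C68·ε` (d = 3, N = 2) —
`j`-FREE — so its three windows follow from `648000·L·C68·ε ≤ 1` (`hm` exactly; `hN`: `1600·L·C68·ε ≤ 1∕405 < 1∕3 = δ_{SU(2)}`; `hδ1`: `δ ≤ (5∕2)C68ε ≤ 1`) and its remainder is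
`(207360000·L + 1331525∕4)·C68²·ε²`; adding the slack `C68²ε²` makes (69) strict.
WHAT IS HERE (def-free).  §1 the arithmetic `remainder69_eq` (`δ_{SU(2)} = 1∕3` reused from ✓`AvgActionDefect.deltaSU_fin_two`); §2 ★★★ `AlphaInputsT3AC.eq69sym_of_mem_reg68LocalSet` (the `h69` binder of
✓`h71_of_recLarge_of_eq69sym`, from `U₀ ∈ reg68LocalSet k h`, `5 ≤ F.L`, and `∀ j < k, 648000·F.L·C68·eps1Of(j) ≤ 1`); §3 ★★★ `AlphaInputsT3AC.h71_of_recLarge_reg68` (the v4 `h71`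
text at `U₀` for every recorded code `e ∈ P(h)`, from `large67RecSet ∧ reg68LocalSet`, `5 ≤ F.L` and the three displayed record-window rows `648000·L·C68·eps1Of ≤ 1`, `eps1Of ≤ 1`,
`½(2C68·C₂(L) + C₂(L)²)·eps1Of ≤ ¼` — LEAD's theorem with `h69` DISCHARGED).
HONEST FRAMING.  Arithmetic over landed theorems; the record-window rows are DISPLAYED hypotheses (the lane folds them where `T3Scales_window`∕γ₇₁ live), and `5 ≤ L` is a REAL
restriction of the k-uniform Prop. 4 route (`EMLIterUniform`: geometric domination `(d+1)L ≤ L²` fails at `L = 3`) — flagged on the bus, not hidden; nothing here proves NODE O's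
rows, the stub `stub_laneRecordsV3Chi`∕`…V4Chi`, the crux `HistoryTailL`, or a mass gap; count-neutral helper (`--supports stmt-QuantumFields-19936`), registry untouched.  YM₃ on T³
is rung R3 of the programme, NOT the Clay problem.

References: T. Bałaban, Commun. Math. Phys. 102 (1985) 255–275 [Balaban1985UV3] ((67)–(71) p.273); CMP 98 (1985) 17–51 [Balaban1985Averaging] (Prop. 4 (134)–(135) p.38).
-/

set_option autoImplicit false

noncomputable section

namespace Summit.QuantumFields.YangMills.Theorems

open scoped Matrix Matrix.Norms.L2Operator BigOperators
open Literature.MathematicalPhysics.QuantumFieldTheory.Balaban1983to89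
open Literature.MathematicalPhysics.QuantumFieldTheory.Balaban1983to89.B10 (pFun)
open Literature.MathematicalPhysics.QuantumFieldTheory.Balaban1983to89.B10Eq38TorusDomains (plaqsIn)
open Literature.MathematicalPhysics.QuantumFieldTheory.Balaban1983to89.B10Eq70Squaring (blockSum dev)
open Literature.MathematicalPhysics.QuantumFieldTheory.Balaban1983to89.T3ContinuumYM3Torus
open Literature.MathematicalPhysics.QuantumFieldTheory.Balaban1983to89.T3UnitLawDensityEML (ℰp)
open Literature.MathematicalPhysics.QuantumFieldTheory.Balaban1985CMP102
open Literature.MathematicalPhysics.QuantumFieldTheory.Balaban1985CMP102.Setting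
open T4Continuum BlockAveraging ExpMeanLog
open Summit.QuantumFields.Balaban3D.Carriers
open Summit.QuantumFields.Balaban3D.Proofs.Primitives (AlphaConsts)
open Summit.QuantumFields.Balaban3D.Proofs.ScalesArithmetic (gk_pos gk_le_one)
open Summit.QuantumFields.Balaban3D.Proofs.CouplingWindow (pFun_pos)
open Summit.QuantumFields.Balaban3D.Proofs.TorusLift (zOf)
open Summit.QuantumFields.Balaban3D.Proofs.LiftBridge (liftCfg)
open Summit.QuantumFields.Balaban3D.Proofs.Run3SmallFactors (regionT)
open Summit.QuantumFields.YangMills.Theorems.SymAvgCover (norm_plaqHol_le_of_mem_reg68LocalSet)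
open Summit.QuantumFields.YangMills.Theorems.SymAvgSixtyNine (dist1_plaqHol_iter_le_blockSum_of_cover)

/-! ## §1 The arithmetic of the remainder (`δ_{SU(2)} = 1∕3` is ✓`AvgActionDefect.deltaSU_fin_two`) -/

/-- The arithmetic of the (69)_sym remainder at d = 3, N = 2 and the (68) radius `a = ½C68·ε·X⁻²` (`X = L^j`): with `t := X·(5·X·a) = (5∕2)·C68·ε` the assembly's remainder
`13·t² + (4·(324·L·25) + 52)·(32·t)²` equals `(207360000·L + 1331525∕4)·C68²·ε²`. [folklore] -/
theorem remainder69_eq (Lr C ε X : ℝ) (hX : X ≠ 0) :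
    13 * (X * (((3 : ℝ) + 2) * X * (C / 2 * ε * (X⁻¹) ^ 2))) ^ 2 +
        (4 * (324 * Lr * ((3 : ℝ) + 2) ^ 2) + 52) * (2 * (2 : ℝ) ^ 2 * (((3 : ℝ) + 1) * X * (((3 : ℝ) + 2) * X * (C / 2 * ε * (X⁻¹) ^ 2)))) ^ 2 =
      (207360000 * Lr + 1331525 / 4) * C ^ 2 * ε ^ 2 := by
  field_simp
  ring

/-! ## §2 (69)_sym at the class of record: the `h69` binder of `h71_of_recLarge_of_eq69sym` -/

section T3

variable {F : T3Family} {𝔠 : AlphaConsts F.L (suGroupModel 2).N} {γ : ℝ} {hγ : 0 < γ} {hγ1 : γ ≤ (min 𝔠.gamma0 1) ^ 2} {K : ℕ}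

/-- **★★★ (69)_sym AT THE CLASS OF RECORD, IN THE `h69` SHAPE.**  For `5 ≤ L`, `k ≤ K`, a history `h`, `U₀ ∈ reg68LocalSet k h`, and the window `648000·L·C68·eps1Of(j) ≤ 1` at every
`j < k`: every recorded `p′ ∈ P_j(h)` has `|Ū₀^{(j)}(∂p′) − 1| < blockSum (L^j) (L^j•z(p′)) μ ν (dev (lift U₀) μ ν) + b` with `0 ≤ b ≤ (207360000·L + 1331529∕4)·C68²·eps1Of(j)²`
(`j`-FREE constant, no `κ`).  Proof: the (68) reading (`norm_plaqHol_le_of_mem_reg68LocalSet`) feeds ★w7 g3's assembly `dist1_plaqHol_iter_le_blockSum_of_cover` at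
`a = ½C68·eps1Of(j)·L^{−2j}`; §1 arithmetic. [cite: Balaban1985UV3, (68)–(69) p.273; Balaban1985Averaging, Prop. 4 (134)–(135) p.38] -/
theorem AlphaInputsT3AC.eq69sym_of_mem_reg68LocalSet (hL5 : 5 ≤ F.L) {k : ℕ} (hk : k ≤ K) {h : Hist (F.P K) k}
    {U₀ : GaugeField (F.P K) 0 (Matrix.specialUnitaryGroup (Fin 2) ℂ)} (hReg : U₀ ∈ AlphaInputsT3AC.reg68LocalSet F 𝔠 γ hγ hγ1 K k h)
    (hwin : ∀ j, j < k → 648000 * (F.L : ℝ) * 𝔠.C68 * eps1Of (T3Scales F γ hγ (hγ1.trans (sq_min_one_le _ 𝔠.gamma0_pos)) K) 𝔠.lane.carrier j ≤ 1) :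
    ∀ (j : Fin k) (p : Plaq (F.P K) j), p ∈ h j → ∃ b : ℝ, 0 ≤ b ∧
      b ≤ (207360000 * (F.L : ℝ) + 1331529 / 4) * 𝔠.C68 ^ 2 * (eps1Of (T3Scales F γ hγ (hγ1.trans (sq_min_one_le _ 𝔠.gamma0_pos)) K) 𝔠.lane.carrier j) ^ 2 ∧
      GaugeGroup.dist1 (GaugeField.plaqHol (Averaging.iter (fun l => BlockAveraging.blockAvg (P := F.P K) (j := l) ℰp) j U₀) p) <
        blockSum (F.L ^ (j : ℕ)) ((F.L ^ (j : ℕ) : ℕ) • zOf p) p.μ p.ν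
          (dev (liftCfg (S := T3Scales F γ hγ (hγ1.trans (sq_min_one_le _ 𝔠.gamma0_pos)) K) (suGroupModel 2) U₀) p.μ p.ν) + b := by
  intro j p hp
  set S : Scales F.L := T3Scales F γ hγ (hγ1.trans (sq_min_one_le _ 𝔠.gamma0_pos)) K with hS
  set ε : ℝ := eps1Of S 𝔠.lane.carrier j with hε
  set X : ℝ := (F.L : ℝ) ^ (j : ℕ) with hX
  have hjK : (j : ℕ) ≤ K := by have := j.2; omega
  have hj1 : (j : ℕ) + 1 ≤ S.P.m + S.P.K := by show (j : ℕ) + 1 ≤ F.m + K; have := j.2; omega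
  have hLS : S.P.d + 2 ≤ S.P.L := by show 3 + 2 ≤ F.L; omega
  have hL1 : (1 : ℝ) ≤ F.L := by exact_mod_cast F.hL.2.le
  have hL0 : (0 : ℝ) < F.L := by linarith
  have hX0 : 0 < X := pow_pos hL0 _
  have hX1 : 1 ≤ X := one_le_pow₀ hL1
  have hC : 0 < 𝔠.C68 := 𝔠.C68_pos
  have hgj : 0 < S.gk j := gk_pos S j
  have hε0 : 0 < ε := mul_pos hgj (pFun_pos _ _ _ 𝔠.b₀_pos hgj (gk_le_one S S.gK_le_one j hjK))
  have hw := hwin j j.2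
  have hCε : 𝔠.C68 * ε ≤ 1 / 648000 := by nlinarith
  -- the (68) radius and its reading on the cover
  set a : ℝ := 𝔠.C68 / 2 * ε * (X⁻¹) ^ 2 with ha
  have ha0 : 0 ≤ a := by positivity
  have hU : ∀ q ∈ plaqsIn 0 (plaqCover p),
      ‖((GaugeField.plaqHol U₀ q : Matrix.specialUnitaryGroup (Fin 2) ℂ) : Matrix (Fin 2) (Fin 2) ℂ) - 1‖ ≤ a := by
    intro q hq
    have h := norm_plaqHol_le_of_mem_reg68LocalSet hk hReg j hp q hq
    rw [ha, hε, hX]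
    exact h
  -- letters of the generic assembly at `S`
  have hd3 : (S.P.d : ℝ) = 3 := by rw [show S.P.d = 3 from rfl]; norm_num
  have hLL : (S.P.L : ℝ) = F.L := by rw [show S.P.L = F.L from rfl]
  have hcard : (Fintype.card (Fin 2) : ℝ) = 2 := by rw [Fintype.card_fin]; norm_num
  have ht : X * (((3 : ℝ) + 2) * X * a) = 5 / 2 * 𝔠.C68 * ε := by
    rw [ha]; field_simp; ring
  have hm80 : 2 * (2 : ℝ) ^ 2 * (((3 : ℝ) + 1) * X * (((3 : ℝ) + 2) * X * a)) = 80 * 𝔠.C68 * ε := by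
    rw [ha]; field_simp; ring
  have hδ1 : ((S.P.d : ℝ) + 2) * (S.P.L : ℝ) ^ (j : ℕ) * a ≤ 1 := by
    rw [hd3, hLL]
    have h1 : ((3 : ℝ) + 2) * X * a = 5 / 2 * 𝔠.C68 * ε * X⁻¹ := by rw [ha]; field_simp; ring
    rw [← hX, h1]
    have h2 : X⁻¹ ≤ 1 := inv_le_one_of_one_le₀ hX1
    have h3 : 0 ≤ 5 / 2 * 𝔠.C68 * ε := by positivity
    calc 5 / 2 * 𝔠.C68 * ε * X⁻¹ ≤ 5 / 2 * 𝔠.C68 * ε * 1 := mul_le_mul_of_nonneg_left h2 h3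
      _ ≤ 1 := by nlinarith
  have hm : 324 * (S.P.L : ℝ) * ((S.P.d : ℝ) + 2) ^ 2 *
      (2 * (Fintype.card (Fin 2) : ℝ) ^ 2 * (((S.P.d : ℝ) + 1) * (S.P.L : ℝ) ^ (j : ℕ) * (((S.P.d : ℝ) + 2) * (S.P.L : ℝ) ^ (j : ℕ) * a))) ≤ 1 := by
    rw [hd3, hLL, hcard, ← hX, hm80]
    nlinarith
  have hN : 4 * (((S.P.d + 2) * S.P.L : ℕ) : ℝ) *
      (2 * (Fintype.card (Fin 2) : ℝ) ^ 2 * (((S.P.d : ℝ) + 1) * (S.P.L : ℝ) ^ (j : ℕ) * (((S.P.d : ℝ) + 2) * (S.P.L : ℝ) ^ (j : ℕ) * a))) < deltaSU (Fin 2) := by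
    have hnat : (((S.P.d + 2) * S.P.L : ℕ) : ℝ) = 5 * F.L := by
      rw [show S.P.d = 3 from rfl, show S.P.L = F.L from rfl]; push_cast; ring
    rw [hnat, hd3, hLL, hcard, ← hX, hm80, AvgActionDefect.deltaSU_fin_two]
    nlinarith
  -- the assembly for the read-regular field
  have hgen := dist1_plaqHol_iter_le_blockSum_of_cover (S := S) (suGroupModel 2) hLS hj1 p U₀ ha0 hU hδ1 hm hN
  rw [hd3, hLL, hcard, ← hX, hm80] at hgen
  have hrem : 13 * (X * (((3 : ℝ) + 2) * X * a)) ^ 2 + (4 * (324 * (F.L : ℝ) * ((3 : ℝ) + 2) ^ 2) + 52) * (80 * 𝔠.C68 * ε) ^ 2 =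
      (207360000 * (F.L : ℝ) + 1331525 / 4) * 𝔠.C68 ^ 2 * ε ^ 2 := by
    rw [← hm80, ha]
    exact remainder69_eq (F.L : ℝ) 𝔠.C68 ε X hX0.ne'
  rw [hrem] at hgen
  refine ⟨(207360000 * (F.L : ℝ) + 1331525 / 4) * 𝔠.C68 ^ 2 * ε ^ 2 + 𝔠.C68 ^ 2 * ε ^ 2, by positivity, le_of_eq (by ring), ?_⟩
  have hslack : 0 < 𝔠.C68 ^ 2 * ε ^ 2 := by positivity
  have hSX : (S.P.L ^ (j : ℕ) : ℕ) = F.L ^ (j : ℕ) := rfl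
  rw [hSX] at hgen
  have hgen' : GaugeGroup.dist1 (GaugeField.plaqHol (Averaging.iter (fun l => BlockAveraging.blockAvg (P := F.P K) (j := l) ℰp) j U₀) p) ≤
      blockSum (F.L ^ (j : ℕ)) ((F.L ^ (j : ℕ) : ℕ) • zOf p) p.μ p.ν (dev (liftCfg (S := S) (suGroupModel 2) U₀) p.μ p.ν) +
        (207360000 * (F.L : ℝ) + 1331525 / 4) * 𝔠.C68 ^ 2 * ε ^ 2 := hgen
  linarith

/-! ## §3 The v4 `h71` text from the class rows and the displayed record windows -/

/-- **★★★ THE R-ii SEAM ROW FOR PRINT's MAP, SUPPLIED FROM B1's CLASS ROWS** (`5 ≤ L`, `k ≤ K`): for `U₀ ∈ large67RecSet k h ∩ reg68LocalSet k h` and every recorded code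
`e ∈ P(h)`, the v4 `h71` text `p(g_{e.1})²∕4 ≤ N·((1∕g_k²)·Σ_{q ∈ regionT e} η_k⁻¹[1 − Re tr U₀(∂q)])` holds, GIVEN the three displayed record-window rows at every `j < k`:
`648000·L·C68·eps1Of(j) ≤ 1`, `eps1Of(j) ≤ 1`, `½(2C68·C₂(L) + C₂(L)²)·eps1Of(j) ≤ ¼` with `C₂(L) = (207360000·L + 1331529∕4)·C68²` — LEAD's ✓`h71_of_recLarge_of_eq69sym` with its
`h69` binder DISCHARGED by §2.  The windows are the lane's to fold (`T3Scales_window`∕γ₇₁); nothing else is assumed. [cite: Balaban1985UV3, (67)–(71) p.273] -/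
theorem AlphaInputsT3AC.h71_of_recLarge_reg68 (hL5 : 5 ≤ F.L) {k : ℕ} (hk : k ≤ K) (h : Hist (F.P K) k)
    {U₀ : GaugeField (F.P K) 0 (Matrix.specialUnitaryGroup (Fin 2) ℂ)}
    (hLarge : U₀ ∈ AlphaInputsT3AC.large67RecSet F 𝔠 γ hγ hγ1 K k h) (hReg : U₀ ∈ AlphaInputsT3AC.reg68LocalSet F 𝔠 γ hγ hγ1 K k h)
    (hwin69 : ∀ j, j < k → 648000 * (F.L : ℝ) * 𝔠.C68 * eps1Of (T3Scales F γ hγ (hγ1.trans (sq_min_one_le _ 𝔠.gamma0_pos)) K) 𝔠.lane.carrier j ≤ 1)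
    (hwin71 : ∀ j, j < k → eps1Of (T3Scales F γ hγ (hγ1.trans (sq_min_one_le _ 𝔠.gamma0_pos)) K) 𝔠.lane.carrier j ≤ 1 ∧
      (2 * 𝔠.C68 * ((207360000 * (F.L : ℝ) + 1331529 / 4) * 𝔠.C68 ^ 2) + ((207360000 * (F.L : ℝ) + 1331529 / 4) * 𝔠.C68 ^ 2) ^ 2) / 2 *
        eps1Of (T3Scales F γ hγ (hγ1.trans (sq_min_one_le _ 𝔠.gamma0_pos)) K) 𝔠.lane.carrier j ≤ 1 / 4)
    (e : ℕ × PlaqCode (F.P K)) (he : e ∈ Hist.disc h) :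
    B10.pFun 𝔠.lane.carrier.b₀ 𝔠.lane.carrier.p₀ ((T3Scales F γ hγ (hγ1.trans (sq_min_one_le _ 𝔠.gamma0_pos)) K).gk e.1) ^ 2 / 4 ≤
      ((suGroupModel 2).N : ℝ) * (((T3Scales F γ hγ (hγ1.trans (sq_min_one_le _ 𝔠.gamma0_pos)) K).gk k)⁻¹ ^ 2 *
        ∑ q ∈ regionT (S := T3Scales F γ hγ (hγ1.trans (sq_min_one_le _ 𝔠.gamma0_pos)) K) e,
          ((T3Scales F γ hγ (hγ1.trans (sq_min_one_le _ 𝔠.gamma0_pos)) K).eta k)⁻¹ * (1 - GaugeGroup.reTr (GaugeField.plaqHol U₀ q))) :=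
  AlphaInputsT3AC.h71_of_recLarge_of_eq69sym (by omega) hk h hLarge hReg
    (AlphaInputsT3AC.eq69sym_of_mem_reg68LocalSet hL5 hk hReg hwin69) hwin71 e he

end T3

end Summit.QuantumFields.YangMills.Theorems

end
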